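import Literature.MathematicalPhysics.QuantumFieldTheory.Balaban1983to89.B12

/-!
# `Balaban1983to89.Node00.LocalizedTermsShape` — T. Bałaban, *Renormalization group approach to lattice gauge field
theories. I*, Commun. Math. Phys. **109** (1987) 249–301 [Balaban1987RG1], §0 (0.22)–(0.27) pp. 256–258: THE SHAPE OF A
LOCALIZED FAMILY `𝐄^{(j)}(X, U)` AS FUNCTIONS OF THE GAUGE FIELD

statement-level skeleton of published theorems with citation tags; proofs where landed; nothing here is a claim about
the Yang–Mills mass gap

CITATION HEADER (verbatim, p. 257 [PDF 9]): *"We assume that the functions 𝐄^{(j)}(U), for regular gauge field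
configurations U, have the following representation  𝐄^{(j)}(U) = Σ_{X∈𝐃_j} 𝐄^{(j)}(X, U),  (0.24)  where 𝐄^{(j)}(X, U) are
analytic and gauge invariant functions of U, depending on U restricted to X, and satisfying the inequality
|𝐄^{(j)}(X, U)| ≦ E₀ exp(−κd_j(X)),  (0.25)  with a sufficiently large constant κ."*; p. 256 [PDF 8]: (0.22)
*"A_k(g_k, V) = A_k(g_k, U_k(V)) = −(1/g_k²) A^η(U_k(V)) + 𝐄_k(U_k(V))"*, (0.23) *"𝐄_k(U_k) = Σ_{j=1}^{k} [−β_j(g_{j−1})A^η(U_k) +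
𝐄^{(j)}(U_k)]"*; p. 258 [PDF 10]: (0.27) *"|𝐄^{(j)}(X, U_k)| ≦ E₀ exp(−κ(L^jη)^{−1}) exp(−½κd_j(X))"* for large X.

WHY THIS FILE (cell `pub-ymgap`, HUMAN RULING D-0062 Track A; NODE 00 object ₈ — definer `node00-def-B`'s SECOND HAND BLOCK,
typed by seat `pub-ymgap-dag-n10-b` ON THE DEFINER'S CUT [NODE00-DEF-B-G0-HAND-WORD-2]).  The tree already holds the
VALUE-level shapes of §0 — `Setup.LocDomainSys` (the classes 𝐃_j with the linear size d_j), `B12.CubeCover` (π_j, X ⊃ □),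
`B12.Sum024Printed` ∕ `Bound025Printed` ∕ `Bound027Printed` ∕ `Chain026Printed` and the kernel chain `B12.chain026_holds`
(numbers at ONE configuration).  This module adds ONLY the FUNCTION-of-the-gauge-field level that the background-field
objects of NODE 00 (₈a `Node00.BackgroundActionOfRecord`: `U_k(V) : GaugeField P 0 G`) consume, and reuses the value-level
shapes BY NAME: a `LocalizedFamily P G` = for every level `j : ℕ` a domain class `sys j : LocDomainSys`, the site-set reading
`sites j X ⊆ T` of each domain, and the terms `term j X : GaugeField P 0 G → ℝ`; the NAMED predicates of the (0.24)
sentence — local dependence (`IsLocalizedIn`, `Localized`), gauge invariance (`GaugeInv`, via `GaugeField.GaugeInvariant`),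
the decay (0.25) RELATIVE TO A DOMAIN of configurations (`DecayBound`, via `B12.Bound025Printed`), the representation (0.24)
(`SumsTo`, via `B12.Sum024Printed`) and the combined (0.22)–(0.24) format over an ABSTRACT action family (`Repr0224`,
transport-generic: no renormalisation transformation is mentioned) — ASSERTED NOWHERE; and bookkeeping theorems only
(`decayBound_iff`, `sumsTo_total`, `chain026_of_decayBound` = `B12.chain026_holds` at the family, `bound027_of_bound025` =
the three-line implication (0.25) ⇒ (0.27) for domains with `d_j(X) ≥ 2(L^jη)⁻¹`).  The level index is `ℕ` (not
`Fin (k+1)`) so that `t j X := fam.term j X U` is literally the datum of `B12.chain026_holds`; `k` enters the predicates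
through `Finset.Icc 1 k`.  The adapter to the record's objects (the reading of `𝐄^{(j+1)}(U_k(V))` as the merged term of
`Node00.BackgroundActionOfRecord.ReprAOfRecord`) is the separate module `Node00.LocalizedTermsAtRecord` (imports ₈a).
HONEST SCOPE.  Shapes over tree objects; NOTHING of Bałaban's asserted — in particular not the existence of such a family
for the record's expansion terms ((0.24)–(0.25) are Theorem 1 ∕ Theorem 3 of [I] + [Balaban1988RG2Cluster]); no estimate;
counts unmoved; one finite torus; not continuum ∕ ℝ⁴ ∕ OS ∕ mass-gap ∕ Clay.  No `sorry`, no instance, no notation.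
-/

noncomputable section

namespace Literature.MathematicalPhysics.QuantumFieldTheory.Balaban1983to89.Node00

open Literature.MathematicalPhysics.QuantumFieldTheory.Balaban1983to89

/-! ## §1. The data of a localized family — (0.24) p. 257 -/

/-- **A LOCALIZED FAMILY `{𝐄^{(j)}(X, ·)}`** — the DATA of the (0.24) sentence p. 257 [PDF 9], *"𝐄^{(j)}(U) = Σ_{X∈𝐃_j}
𝐄^{(j)}(X, U), where 𝐄^{(j)}(X, U) are … functions of U, depending on U restricted to X"*: for every level `j : ℕ` the class
`𝐃_j` of localization domains with its linear size `d_j` (`sys j : Setup.LocDomainSys` — p. 257: *"The class of all these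
localization domains is denoted by 𝐃_j"*, *"the linear size of X, … denoted by d_j(X)"*), the reading of each domain as a set
of sites of the fine torus (`sites j X` — p. 257: *"every localization domain X is a union of continuous space cubes from
π_j"*), and the terms `term j X : GaugeField P 0 G → ℝ` as functions of the fine gauge field (the type of the background
fields `U_k(V)` of (0.21)).  Data only; which family realises the expansion terms of the record is a theorem of [I], not
a field. [cite: Balaban1987RG1, (0.24) p.257] -/
structure LocalizedFamily (P : Params) (G : Type*) where
  /-- the classes `𝐃_j` with the linear sizes `d_j`, one per level `j` -/
  sys : ℕ → LocDomainSys
  /-- the domain `X ∈ 𝐃_j` read as a set of sites of the fine torus -/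
  sites : (j : ℕ) → (sys j).Dom → Set (Site P 0)
  /-- the terms `𝐄^{(j)}(X, ·)` as functions of the fine gauge field -/
  term : (j : ℕ) → (sys j).Dom → GaugeField P 0 G → ℝ

variable {P : Params} {G : Type*}

/-- **«depending on U restricted to X»** (p. 257 [PDF 9], the (0.24) sentence) as a NAMED predicate on a function of the
gauge field and a set of sites `S`: two configurations agreeing on every bond with both endpoints in `S` give the same
value. [cite: Balaban1987RG1, (0.24) p.257] -/
def IsLocalizedIn (S : Set (Site P 0)) (E : GaugeField P 0 G → ℝ) : Prop :=
  ∀ U U' : GaugeField P 0 G, (∀ b : PBond P 0, b.src ∈ S → b.tgt ∈ S → U b = U' b) → E U = E U'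

/-- A function localized in `S` is localized in every larger set (bookkeeping). [cite: Balaban1987RG1, (0.24) p.257] -/
theorem IsLocalizedIn.mono {S S' : Set (Site P 0)} {E : GaugeField P 0 G → ℝ} (h : IsLocalizedIn S E) (hSS' : S ⊆ S') :
    IsLocalizedIn S' E :=
  fun U U' hUU' => h U U' fun b hb hb' => hUU' b (hSS' hb) (hSS' hb')

/-- A constant function is localized in any set (bookkeeping; e.g. the vacuum-energy counterterm p. 258). [cite: Balaban1987RG1, (0.24) p.257] -/
theorem isLocalizedIn_const (S : Set (Site P 0)) (a : ℝ) : IsLocalizedIn (G := G) S (fun _ => a) :=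
  fun _ _ _ => rfl

namespace LocalizedFamily

/-- **Local dependence of the family**: every `𝐄^{(j)}(X, ·)` depends on `U` restricted to `X` (p. 257, the (0.24)
sentence).  A predicate, asserted nowhere. [cite: Balaban1987RG1, (0.24) p.257] -/
def Localized (fam : LocalizedFamily P G) : Prop :=
  ∀ (j : ℕ) (X : (fam.sys j).Dom), IsLocalizedIn (fam.sites j X) (fam.term j X)

/-- **Gauge invariance of the family**: every `𝐄^{(j)}(X, ·)` is a *"gauge invariant function of U"* (p. 257, the (0.24)
sentence; `Setup`'s `GaugeField.GaugeInvariant` by name).  A predicate, asserted nowhere. [cite: Balaban1987RG1, (0.24) p.257] -/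
def GaugeInv [GaugeGroup G] (fam : LocalizedFamily P G) : Prop :=
  ∀ (j : ℕ) (X : (fam.sys j).Dom), GaugeField.GaugeInvariant (fam.term j X)

/-- **(0.25) FOR THE FAMILY, RELATIVE TO A DOMAIN OF CONFIGURATIONS** — p. 257 [PDF 9]: *"|𝐄^{(j)}(X, U)| ≦ E₀ exp(−κd_j(X))"*
for the levels `j = 1, …, k` and the configurations `U ∈ dom` (print: *"for regular gauge field configurations U"* — the
domain is an ARGUMENT, never all `U`); per configuration this is the tree's `B12.Bound025Printed` by name.  A predicate,
asserted nowhere. [cite: Balaban1987RG1, (0.25) p.257] -/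
def DecayBound (fam : LocalizedFamily P G) (k : ℕ) (dom : Set (GaugeField P 0 G)) (E₀ κ : ℝ) : Prop :=
  ∀ U ∈ dom, ∀ j ∈ Finset.Icc 1 k, B12.Bound025Printed (S := fam.sys j) (fun X => fam.term j X U) E₀ κ

/-- **(0.24) FOR THE FAMILY, RELATIVE TO A DOMAIN OF CONFIGURATIONS** — p. 257 [PDF 9]: *"𝐄^{(j)}(U) = Σ_{X∈𝐃_j} 𝐄^{(j)}(X, U)"*
for the levels `j = 1, …, k` and `U ∈ dom`, the represented functions `Etot j = 𝐄^{(j)}` being an ARGUMENT; per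
configuration this is the tree's `B12.Sum024Printed` by name.  A predicate, asserted nowhere. [cite: Balaban1987RG1, (0.24) p.257] -/
def SumsTo (fam : LocalizedFamily P G) (k : ℕ) (dom : Set (GaugeField P 0 G)) (Etot : ℕ → GaugeField P 0 G → ℝ) : Prop :=
  ∀ U ∈ dom, ∀ j ∈ Finset.Icc 1 k, B12.Sum024Printed (S := fam.sys j) (Etot j U) (fun X => fam.term j X U)

/-- **(0.27) FOR THE FAMILY ON THE LARGE DOMAINS, RELATIVE TO A DOMAIN OF CONFIGURATIONS** — p. 258 [PDF 10]: *"If its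
localization domain X is large … then the inequality (0.25) ensures that |𝐄^{(j)}(X, U_k)| ≦ E₀ exp(−κ(L^jη)^{−1})
exp(−½κd_j(X))"*; `large j` is an abstract predicate on `𝐃_j` (the tree's `B12.Bound027Printed` by name, per
configuration).  A predicate, asserted nowhere. [cite: Balaban1987RG1, (0.27) p.258] -/
def LargeDecay (fam : LocalizedFamily P G) (k : ℕ) (dom : Set (GaugeField P 0 G)) (large : (j : ℕ) → (fam.sys j).Dom → Prop)
    (E₀ κ L η : ℝ) : Prop :=
  ∀ U ∈ dom, ∀ j ∈ Finset.Icc 1 k, B12.Bound027Printed (S := fam.sys j) (large j) (fun X => fam.term j X U) E₀ κ L η j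

/-! ## §2. The combined format (0.22)–(0.24) over an abstract action family -/

/-- **THE FORMAT (0.22)–(0.24) OVER AN ABSTRACT ACTION FAMILY** — p. 256 [PDF 8], (0.22) *"A_k(g_k, V) = A_k(g_k, U_k(V)) =
−(1/g_k²)A^η(U_k(V)) + 𝐄_k(U_k(V))"*, (0.23) *"𝐄_k(U_k) = Σ_{j=1}^{k} [−β_j(g_{j−1})A^η(U_k) + 𝐄^{(j)}(U_k)]"*, (0.24)
*"𝐄^{(j)}(U) = Σ_{X∈𝐃_j} 𝐄^{(j)}(X, U)"*, combined: for every background configuration `U ∈ dom`,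
`A k (avg k U) = −(1/(g k)²)·Aη U + Σ_{j=1}^{k} (−(b j)·Aη U + Σ_{X∈𝐃_j} 𝐄^{(j)}(X, U))`, where the actions `A j` on the
level-`j` fields, the averaging `avg j = Ū^j` (so that `A k (avg k U) = A_k(V)` at `U = U_k(V)`, (0.21)), the Wilson action
`Aη`, the couplings `g` and the β-values `b j = β_j(g_{j−1})` are ARGUMENTS (transport-generic: no renormalisation
transformation is mentioned).  A predicate, asserted nowhere. [cite: Balaban1987RG1, (0.22)–(0.24) pp.256–257] -/
def Repr0224 (fam : LocalizedFamily P G) (k : ℕ) (dom : Set (GaugeField P 0 G))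
    (A : (j : ℕ) → GaugeField P j G → ℝ) (avg : (j : ℕ) → GaugeField P 0 G → GaugeField P j G)
    (Aη : GaugeField P 0 G → ℝ) (g b : ℕ → ℝ) : Prop :=
  ∀ U ∈ dom, A k (avg k U) =
    -(1 / (g k) ^ 2) * Aη U + ∑ j ∈ Finset.Icc 1 k, (-(b j) * Aη U + ∑ X : (fam.sys j).Dom, fam.term j X U)

/-! ## §3. Bookkeeping (no estimate) -/

/-- (0.25) for the family unfolds to the pointwise inequalities `|𝐄^{(j)}(X, U)| ≤ E₀ e^{−κ d_j(X)}`, `U ∈ dom`,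
`1 ≤ j ≤ k`. [cite: Balaban1987RG1, (0.25) p.257] -/
theorem decayBound_iff (fam : LocalizedFamily P G) (k : ℕ) (dom : Set (GaugeField P 0 G)) (E₀ κ : ℝ) :
    fam.DecayBound k dom E₀ κ ↔
      ∀ U ∈ dom, ∀ j ∈ Finset.Icc 1 k, ∀ X : (fam.sys j).Dom,
        |fam.term j X U| ≤ E₀ * Real.exp (-κ * (fam.sys j).dj X) :=
  Iff.rfl

/-- (0.24) for the family gives the total `Σ_{j=1}^{k} 𝐄^{(j)}(U) = Σ_{j=1}^{k} Σ_{X∈𝐃_j} 𝐄^{(j)}(X, U)` on the domain (the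
inner sum of (0.23); finite sums). [cite: Balaban1987RG1, (0.23)–(0.24) pp.256–257] -/
theorem sumsTo_total {fam : LocalizedFamily P G} {k : ℕ} {dom : Set (GaugeField P 0 G)}
    {Etot : ℕ → GaugeField P 0 G → ℝ} (h : fam.SumsTo k dom Etot) {U : GaugeField P 0 G} (hU : U ∈ dom) :
    ∑ j ∈ Finset.Icc 1 k, Etot j U = ∑ j ∈ Finset.Icc 1 k, ∑ X : (fam.sys j).Dom, fam.term j X U :=
  Finset.sum_congr rfl fun j hj => h U hU j hj

/-- Under (0.24) the combined format (0.22)–(0.24) is the format (0.22)–(0.23) with the represented functions `𝐄^{(j)}`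
(rewrite only). [cite: Balaban1987RG1, (0.22)–(0.24) pp.256–257] -/
theorem repr0224_iff_of_sumsTo {fam : LocalizedFamily P G} {k : ℕ} {dom : Set (GaugeField P 0 G)}
    {Etot : ℕ → GaugeField P 0 G → ℝ} (h : fam.SumsTo k dom Etot)
    (A : (j : ℕ) → GaugeField P j G → ℝ) (avg : (j : ℕ) → GaugeField P 0 G → GaugeField P j G)
    (Aη : GaugeField P 0 G → ℝ) (g b : ℕ → ℝ) :
    fam.Repr0224 k dom A avg Aη g b ↔
      ∀ U ∈ dom, A k (avg k U) = -(1 / (g k) ^ 2) * Aη U + ∑ j ∈ Finset.Icc 1 k, (-(b j) * Aη U + Etot j U) := by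
  refine forall₂_congr fun U hU => ?_
  have hs : ∑ j ∈ Finset.Icc 1 k, (-(b j) * Aη U + ∑ X : (fam.sys j).Dom, fam.term j X U) =
      ∑ j ∈ Finset.Icc 1 k, (-(b j) * Aη U + Etot j U) :=
    Finset.sum_congr rfl fun j hj => by rw [show Etot j U = _ from h U hU j hj]
  rw [hs]

/-- **THE CHAIN (0.26) FOR THE FAMILY** — p. 257 [PDF 9]: on the domain, (0.25) and the two silent inputs of the printed
chain (the tree-decay sums over `X ⊃ □` bounded by `K₀`; the counts `|π_j| = M⁻⁴|T₁^{(j)}|`, `|T₁^{(j)}| = L^{4(k−j)}|T₁^{(k)}|`)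
give `|Σ_{j=1}^{k} Σ_X 𝐄^{(j)}(X, U)| ≤ E₀·K₀·M⁻⁴·|T₁^{(k)}|·η⁻⁴` — the tree's kernel chain `B12.chain026_holds` at the datum
`t j X := 𝐄^{(j)}(X, U)`, nothing more. [cite: Balaban1987RG1, (0.26) p.257] -/
theorem chain026_of_decayBound {fam : LocalizedFamily P G} {k : ℕ} {dom : Set (GaugeField P 0 G)} {E₀ κ : ℝ}
    (h : fam.DecayBound k dom E₀ κ) (C : (j : ℕ) → B12.CubeCover (fam.sys j)) (K₀ M L : ℝ) (N : ℕ → ℝ)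
    (hE₀ : 0 ≤ E₀) (hK₀ : 0 ≤ K₀) (hM : 0 < M) (hL : 2 ≤ L ^ 4) (hNk : 0 ≤ N k)
    (hTree : ∀ j ∈ Finset.Icc 1 k, ∀ c : (C j).Cube,
      ∑ X ∈ (C j).above c, Real.exp (-κ * (fam.sys j).dj X) ≤ K₀)
    (hπ : ∀ j ∈ Finset.Icc 1 k, (Fintype.card (C j).Cube : ℝ) = M⁻¹ ^ 4 * N j)
    (hSites : ∀ j ∈ Finset.Icc 1 k, N j = (L ^ (k - j)) ^ 4 * N k) {U : GaugeField P 0 G} (hU : U ∈ dom) :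
    ‖∑ j ∈ Finset.Icc 1 k, ∑ X : (fam.sys j).Dom, fam.term j X U‖ ≤ E₀ * K₀ * M⁻¹ ^ 4 * N k * ((L ^ k)⁻¹)⁻¹ ^ 4 :=
  B12.chain026_holds k fam.sys C (fun j X => fam.term j X U) E₀ κ K₀ M L N hE₀ hK₀ hM hL hNk
    (fun j hj X => by rw [Real.norm_eq_abs]; exact h U hU j hj X) hTree hπ hSites

end LocalizedFamily

/-- **(0.25) ⇒ (0.27) FOR A LARGE DOMAIN** — p. 258 [PDF 10]: *"If its localization domain X is large, for example it is
not contained in any cube □̃, with □ ∈ π_k, then the inequality (0.25) ensures that"* (0.27): the three-line real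
identity behind the sentence, with "large" READ as `d_j(X) ≥ 2(L^jη)^{−1}` (for `κ, E₀ ≥ 0`):
`E₀e^{−κd} ≤ E₀e^{−κ(L^jη)^{−1}}e^{−½κd}`.  (`B12.Bound027Printed` displays (0.27) with "large" abstract; this is the
implication its docstring leaves untyped.) [cite: Balaban1987RG1, (0.27) p.258] -/
theorem bound027_of_bound025 {E d E₀ κ s : ℝ} (hE₀ : 0 ≤ E₀) (hκ : 0 ≤ κ) (h025 : |E| ≤ E₀ * Real.exp (-κ * d))
    (hlarge : 2 * s⁻¹ ≤ d) :
    |E| ≤ E₀ * Real.exp (-κ * s⁻¹) * Real.exp (-(1 / 2) * κ * d) := by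
  refine h025.trans ?_
  rw [mul_assoc, ← Real.exp_add]
  refine mul_le_mul_of_nonneg_left (Real.exp_le_exp.mpr ?_) hE₀
  nlinarith

namespace LocalizedFamily

/-- **(0.27) for the family from (0.25)** on the domains with `d_j(X) ≥ 2(L^jη)^{−1}` (`large` READ as that size
condition; bookkeeping from `bound027_of_bound025`). [cite: Balaban1987RG1, (0.27) p.258] -/
theorem largeDecay_of_decayBound {fam : LocalizedFamily P G} {k : ℕ} {dom : Set (GaugeField P 0 G)} {E₀ κ : ℝ}
    (h : fam.DecayBound k dom E₀ κ) (hE₀ : 0 ≤ E₀) (hκ : 0 ≤ κ) (L η : ℝ)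
    (large : (j : ℕ) → (fam.sys j).Dom → Prop)
    (hlarge : ∀ j (X : (fam.sys j).Dom), large j X → 2 * (L ^ j * η)⁻¹ ≤ (fam.sys j).dj X) :
    fam.LargeDecay k dom large E₀ κ L η :=
  fun U hU j hj X hX => bound027_of_bound025 hE₀ hκ (h U hU j hj X) (hlarge j X hX)

end LocalizedFamily

end Literature.MathematicalPhysics.QuantumFieldTheory.Balaban1983to89.Node00

end
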